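import Summits.QuantumFields.YangMills.Theorems.ForcedResponseSkewnessResponseLocalisationSmearedDefs
import HarnessLib

/-!
# Route `ForcedResponseSkewness`: vocabulary of the FEMTO ENGINE INTERFACE (both cruxes; lead `ym-line-frs-p1` g6, 2026-08-28)

Route-posited statements (D-0016 `<Route>…Defs`-class file, third volume after
`ForcedResponseSkewnessResponseLocalisationDefs.lean` / `…SmearedDefs.lean`).  NOTHING here is asserted: every
`def … : Prop` is a line statement some registered stub proves or a bundle of such statements (none is a literature
fact, none restates a crux).  No summit is proved by any of this (leaf R2a `BalabanLadder.NT`, conditional rung line;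
the physics laws, the cruxes, `NT` and the Yang–Mills mass gap are NOT proved).

After generation g5 the two femto cruxes of the route rest on exactly three engine-grade statements along a pinned
unit — the plane-resolved frozen-boundary law `FBL6` (E0′, shared with the spine's crux 19353), the centred
oscillation law `CentredOscLawSigR` (AF covariance response, deciding crux 26871) and the centred log two-point
ceiling `CentredFemtoLogSigR` (AF, crux 24275) — the last two already in ENGINE FORM (centre of the centred cubes
`[-N,N]⁴`, arbitrary exteriors, no reference values).  This file puts the shared E0′ stub in the same form and names
the bundle:

* `FBL6Osc G r a` — the plane-resolved boundary law in REFERENCE-FREE OSCILLATION form, ONE orientation: for radii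
  `R ≥ D` with `(2R+1)·a(β) ≤ ℓ₁` and any TWO exteriors `η, η'` of the centred cube `[-R,R]⁴`, the kernel means of the
  single-plane field `plane (0,1) 0` at the centre differ by at most `C₁/(R+1)⁴`.  VERBATIM the hypothesis of the
  spine's landed reduction `Cruxes.NT.BoundaryLaw.fbl6_of_oscillation` (file
  `Theorems/BalabanLadderNTBoundaryLawOscillation.lean`: translations, a coordinate permutation and DLR antitonicity
  give every cube, site and orientation, the reference value being manufactured from one large cube), with the
  threshold radius `D` bundled existentially; its cover / geometric-sequence forms are the spine's
  `fbl6_of_oscillation_cover` / `fbl6_of_oscillation_seq`.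
* `FBL6OscSigR` — the same along a unit pinned by a compactly supported positive-time clause-(i) floor witness (the
  E0′ stub `stub_fbl6Osc` of skeletons v4 (26871) / v6 (24275); `FBL6PinnedSigR` is then DERIVED:
  `FemtoEngine.fbl6PinnedSigR_of_osc`, file `Theorems/ForcedResponseSkewnessFemtoEngineInterface.lean`).
* `FemtoEngineSigR := FBL6OscSigR ∧ CentredOscLawSigR ∧ CentredFemtoLogSigR` — THE ENGINE INTERFACE of the route:
  three statements of one shape (centred femto cubes `[-N,N]⁴` along a pinned unit, the centre, arbitrary
  exteriors — two compared for the first two, one for the third), from which BOTH cruxes follow by landed analysis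
  (`FemtoEngine.responseLocalisation_of_femtoEngine`, `FemtoEngine.runningCouplingCeiling_of_femtoEngine`) and hence,
  with the declared residual `FloorWithScalingLimits`, the leaf `NT` (`FemtoEngine.nt_of_femtoEngine`).  It is the
  ONE declared physics debt of the route outside the residual (engine: Bałaban small-field renormalisation group in a
  femto cube with prescribed exterior, extended to one- and two-point functions of the action density — announced for
  observables in Bałaban 1989, CMP 122, p. 356; not in print).

Refs: route file `Theses/ForcedResponseSkewness.lean`; engine note `Cruxes/ResponseLocalisation/Lines/signed-femto-collar-engine.md`;
spine `Cruxes/NT/Lines/engine-target.md`; Georgii 2011 §8.1 (influence of boundary conditions).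
-/

set_option autoImplicit false

noncomputable section

namespace Summit.QuantumFields.YangMills.Cruxes.ResponseLocalisation.Birth

open MeasureTheory Filter Topology
open Literature.MathematicalPhysics.QuantumFieldTheory Literature.MathematicalPhysics.QuantumLattice
open Literature.Probability.LatticeModels
open Summit.QuantumFields.YangMills.Cruxes.OSLegsFromFemtoAndGap.DlrCollarTransfer
open Summit.QuantumFields.YangMills.Cruxes.RunningCouplingCeiling.Pointwise (CentredFemtoLogSigR)

section Osc

variable (G : Type) [Group G] [TopologicalSpace G] [IsTopologicalGroup G] [CompactSpace G]
  [MeasurableSpace G] [BorelSpace G] (r : LatticeRep G) (a : ℝ → ℝ)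

/-- **Plane-resolved frozen-boundary law in reference-free oscillation form, one orientation** (E0′/FEMTO class,
engine form of the shared stub): a threshold radius `D`, a constant `C₁`, a coupling threshold `β₁` and a femto scale
`ℓ₁ > 0` such that for `β ≥ β₁`, every radius `R ≥ D` with `(2R+1)·a(β) ≤ ℓ₁` and every two exteriors `η, η'` of the
centred cube `[-R,R]⁴`, the kernel means of the single-plane field of orientation `(0,1)` at the centre differ by at
most `C₁/(R+1)⁴`.  (Verbatim the hypothesis of the spine's `BoundaryLaw.fbl6_of_oscillation`, `D` bundled.) -/
def FBL6Osc : Prop :=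
  ∃ (D : ℕ) (C₁ β₁ ℓ₁ : ℝ), 0 < ℓ₁ ∧ ∀ β : ℝ, β₁ ≤ β → ∀ R : ℕ, D ≤ R →
    ((2 * R + 1 : ℕ) : ℝ) * a β ≤ ℓ₁ → ∀ η η' : LGConfig 4 G,
      |kerE G r β (fun _ => -(R : ℤ)) (2 * R + 1) η (plane G r (0, 1) 0) -
        kerE G r β (fun _ => -(R : ℤ)) (2 * R + 1) η' (plane G r (0, 1) 0)| ≤ C₁ / ((R : ℝ) + 1) ^ 4

end Osc

/-- **Statement of `stub_fbl6Osc`** (E0′/FEMTO class; the shared engine stub of route `ForcedResponseSkewness` in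
engine form, registered on both cruxes 26871 and 24275): the oscillation form `FBL6Osc G r a` of the plane-resolved
frozen-boundary law along a unit map pinned by a compactly supported positive-time clause-(i) floor witness. -/
def FBL6OscSigR : Prop :=
  ∀ (G : Type) [Group G] [TopologicalSpace G] [IsTopologicalGroup G] [CompactSpace G],
    IsCompactSimpleLieGroup G →
    letI : MeasurableSpace G := borel G
    haveI : BorelSpace G := ⟨rfl⟩
    ∀ (r : LatticeRep G) (a : ℝ → ℝ), (∀ β, 0 < a β) → Filter.Tendsto a Filter.atTop (nhds 0) →
      (∃ (v₀ : SchwartzMap (EuclideanSpace ℝ (Fin 4)) ℝ) (ε β₅ Λ₅ : ℝ), HasCompactSupport v₀ ∧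
        tsupport v₀ ⊆ {y : EuclideanSpace ℝ (Fin 4) | 0 < y 0} ∧ 0 < ε ∧
        ∀ β : ℝ, β₅ ≤ β → ∀ L : ℕ, Λ₅ ≤ a β * L → ε ≤ Q2 G r β L (a β) (thetaTest 4 v₀) v₀) →
      FBL6Osc G r a

/-- **The femto engine interface of route `ForcedResponseSkewness`** (the ONE declared physics debt outside the
residual): the three engine-form femto laws along a pinned unit — the plane-resolved boundary law in oscillation form
(E0′, shared with the spine), the centred reference-free oscillation law for the signed radially smeared near-pair
conditional covariance (AF, deciding crux 26871) and the centred femto log two-point ceiling (AF, crux 24275). -/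
def FemtoEngineSigR : Prop :=
  FBL6OscSigR ∧ CentredOscLawSigR ∧ CentredFemtoLogSigR

/-! ## The interface IN A REFERENCE UNIT (lead `ym-line-frs-p1` g7, 2026-08-28): what the pinned unit costs

The three Sigs above quantify over EVERY unit map `a → 0⁺` pinned by a clause-(i) floor.  An engine delivers the laws
in ITS OWN unit `u` (for the spine: the two-loop unit of record); the laws move from `u` to any unit two-sidedly
comparable with `u` by pure bookkeeping (`Theorems/ForcedResponseSkewnessFemtoEngineUnitTransfer.lean`:
`FemtoEngine.femtoEngineAt_of_unit`, `FemtoEngine.femtoEngineSigR_of_ref`), so the pinned Sigs are EXACTLY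
«laws in one unit `u`» ∧ «every floor-pinned unit is two-sidedly comparable with `u`» (`FloorPinsUnit`; fine side:
no floor survives in a unit drifting finer than `u` — decay of the density two-point function beyond the correlation
length, IR-flavoured; coarse side: no floor survives in a unit drifting coarser — the asymptotic-freedom log ceiling,
UV).  Nothing here is asserted; these are statements. -/

section RefUnit

variable (G : Type) [Group G] [TopologicalSpace G] [IsTopologicalGroup G] [CompactSpace G]
  [MeasurableSpace G] [BorelSpace G] (r : LatticeRep G) (a : ℝ → ℝ)

/-- **Centred femto log two-point law in the unit `a`** (E-log body with the unit explicit; AF/FEMTO class): VERBATIM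
the conclusion of `CentredFemtoLogSigR` for `(G, r, a)` — a femto scale `ℓ₂`, constants `C₂, β₂, n₀` and a
scale-indexed collar `K ≥ 1` with `s·K(s) → 0` such that for `β ≥ β₂`, every centred femto cube `[-N,N]⁴`
(`(2N+1)·a(β) ≤ ℓ₂`), EVERY exterior and every `y` with `n₀ ≤ ‖y‖`, `(K(‖y‖·a(β)) + 1)·‖y‖ ≤ N+1`:
`‖y‖⁸ |kerCov_η(dens 0, dens y)| ≤ C₂ / log²(1/(‖y‖·a(β)))`. -/
def CentredFemtoLog : Prop :=
  ∃ (ℓ₂ C₂ β₂ : ℝ) (K : ℝ → ℝ) (n₀ : ℕ), 0 < ℓ₂ ∧ (∀ s, 1 ≤ K s) ∧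
    Filter.Tendsto (fun s : ℝ => s * K s) (nhdsWithin 0 (Set.Ioi 0)) (nhds 0) ∧
    ∀ β : ℝ, β₂ ≤ β → ∀ N : ℕ, ((2 * N + 1 : ℕ) : ℝ) * a β ≤ ℓ₂ →
      ∀ (η : LGConfig 4 G) (y : Fin 4 → ℤ), (n₀ : ℝ) ≤ ‖siteToE y‖ →
        (K (‖siteToE y‖ * a β) + 1) * ‖siteToE y‖ ≤ (N : ℝ) + 1 →
          ‖siteToE y‖ ^ 8 * |kerCov G r β (fun _ => -(N : ℤ)) (2 * N + 1) η (dens G r 0) (dens G r y)| ≤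
            C₂ / Real.log (1 / (‖siteToE y‖ * a β)) ^ 2

/-- **The femto engine laws in ONE unit** (hypothesis-free bodies): E0′ `FBL6Osc`, E-sym `CentredOscLaw`, E-log
`CentredFemtoLog` for `(G, r, a)` — what an engine delivers in its own unit. -/
def FemtoEngineAt : Prop :=
  FBL6Osc G r a ∧ CentredOscLaw G r a ∧ CentredFemtoLog G r a

/-- **Floors pin the unit to `a`, two-sidedly**: every unit map `a' → 0⁺` carrying a compactly supported positive-time
clause-(i) floor witness (the pinning hypothesis of the three Sigs) is eventually two-sidedly comparable with `a`:
`c·a' ≤ a ≤ C·a'` for some `c > 0`.  (Fine side: IR-flavoured decay of the density two-point function beyond the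
correlation length; coarse side: the asymptotic-freedom log ceiling.  Physics; not asserted.) -/
def FloorPinsUnit : Prop :=
  ∀ a' : ℝ → ℝ, (∀ β, 0 < a' β) → Filter.Tendsto a' Filter.atTop (nhds 0) →
    (∃ (v₀ : SchwartzMap (EuclideanSpace ℝ (Fin 4)) ℝ) (ε β₅ Λ₅ : ℝ), HasCompactSupport v₀ ∧
      tsupport v₀ ⊆ {y : EuclideanSpace ℝ (Fin 4) | 0 < y 0} ∧ 0 < ε ∧
      ∀ β : ℝ, β₅ ≤ β → ∀ L : ℕ, Λ₅ ≤ a' β * L → ε ≤ Q2 G r β L (a' β) (thetaTest 4 v₀) v₀) →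
    ∃ c C : ℝ, 0 < c ∧ ∀ᶠ β in Filter.atTop, c * a' β ≤ a β ∧ a β ≤ C * a' β

end RefUnit

/-- **The femto engine interface in a reference unit**: for every compact simple `G` and lattice representation `r`
there is ONE unit map `u → 0⁺` in which the three engine laws hold (`FemtoEngineAt G r u`) and to which every
floor-pinned unit is two-sidedly comparable (`FloorPinsUnit G r u`).  Implies `FemtoEngineSigR`
(`FemtoEngine.femtoEngineSigR_of_ref`); it is the honest split of the route's declared debt into «engine output in the
engine's unit» ∧ «unit pinning». -/
def FemtoEngineRefSigR : Prop :=
  ∀ (G : Type) [Group G] [TopologicalSpace G] [IsTopologicalGroup G] [CompactSpace G],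
    IsCompactSimpleLieGroup G →
    letI : MeasurableSpace G := borel G
    haveI : BorelSpace G := ⟨rfl⟩
    ∀ (r : LatticeRep G), ∃ u : ℝ → ℝ, (∀ β, 0 < u β) ∧ Filter.Tendsto u Filter.atTop (nhds 0) ∧
      FemtoEngineAt G r u ∧ FloorPinsUnit G r u

/-! ### The FINE side of the pinning is the only extra (lead g7): the coarse side follows from the engine laws

`FloorPinsUnit G r u` has two halves.  COARSE (`c·a' ≤ u`: no floor survives in a unit drifting coarser than `u`) follows
from the engine laws in the unit `u` alone — the torus log ceiling (`logCeiling_of_femto`) makes `Q2` of any compactly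
supported witness tend to `0` along units `a'/u → ∞` (`FemtoEngine.floorPins_coarse_of_femtoEngineAt`,
`Theorems/ForcedResponseSkewnessFemtoEngineCoarsePin.lean`).  FINE (`u ≤ C·a'`: no floor survives in a unit drifting
finer than `u`) is hyperscaling-weighted decay of the density two-point function BEYOND the femto range — not an engine
output; it is named below and is the route's one interface fact besides the engine. -/

section FinePin

variable (G : Type) [Group G] [TopologicalSpace G] [IsTopologicalGroup G] [CompactSpace G]
  [MeasurableSpace G] [BorelSpace G] (r : LatticeRep G) (a : ℝ → ℝ)

/-- **Floors pin the unit to `a` on the fine side**: every unit map `a' → 0⁺` carrying a compactly supported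
positive-time clause-(i) floor witness is eventually not finer than `a/C`: `a ≤ C·a'`.  (IR-flavoured: decay of the
density two-point function, with the hyperscaling weight `d⁸`, beyond the correlation length.  Physics; not asserted.) -/
def FloorPinsFine : Prop :=
  ∀ a' : ℝ → ℝ, (∀ β, 0 < a' β) → Filter.Tendsto a' Filter.atTop (nhds 0) →
    (∃ (v₀ : SchwartzMap (EuclideanSpace ℝ (Fin 4)) ℝ) (ε β₅ Λ₅ : ℝ), HasCompactSupport v₀ ∧
      tsupport v₀ ⊆ {y : EuclideanSpace ℝ (Fin 4) | 0 < y 0} ∧ 0 < ε ∧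
      ∀ β : ℝ, β₅ ≤ β → ∀ L : ℕ, Λ₅ ≤ a' β * L → ε ≤ Q2 G r β L (a' β) (thetaTest 4 v₀) v₀) →
    ∃ C : ℝ, ∀ᶠ β in Filter.atTop, a β ≤ C * a' β

end FinePin

/-- **The femto engine interface in a reference unit, fine pinning only**: for every compact simple `G` and `r` there
is ONE unit map `u → 0⁺` carrying the three engine laws (`FemtoEngineAt G r u`) such that every floor-pinned unit is
eventually not finer than `u/C` (`FloorPinsFine G r u`).  Implies `FemtoEngineRefSigR` and hence `FemtoEngineSigR`
(`FemtoEngine.femtoEngineSigR_of_fine`): the route's declared debt is «engine output in the engine's unit» ∧ «fine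
pinning». -/
def FemtoEngineFineSigR : Prop :=
  ∀ (G : Type) [Group G] [TopologicalSpace G] [IsTopologicalGroup G] [CompactSpace G],
    IsCompactSimpleLieGroup G →
    letI : MeasurableSpace G := borel G
    haveI : BorelSpace G := ⟨rfl⟩
    ∀ (r : LatticeRep G), ∃ u : ℝ → ℝ, (∀ β, 0 < u β) ∧ Filter.Tendsto u Filter.atTop (nhds 0) ∧
      FemtoEngineAt G r u ∧ FloorPinsFine G r u

/-! ### The fine pinning is HYPERSCALING-WEIGHTED CLUSTERING beyond the femto range (lead g7)

`FloorPinsFine G r u` quantifies over test functions and floors.  It follows from ONE torus-level law in the unit `u` with no test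
functions: the hyperscaling-weighted density two-point function `d⁸·|torusCov β L x y|` tends to `0` at large PHYSICAL separation
`u(β)·d → ∞`, uniformly in `β` large and in large tori (`FemtoEngine.floorPinsFine_of_hyperscalingClustering`,
`Theorems/ForcedResponseSkewnessFemtoEngineFinePin.lean`).  Inside the femto range the same quantity is BOUNDED (`MomentBounds6`, E0′ class);
the decay beyond it is IR content (weaker than exponential clustering with a hyperscaling prefactor; not implied by clustering with a
β-independent prefactor).  With it the route's debt outside the residual reads: ENGINE laws in one unit ∧ this IR-light law in the same
unit — two physics laws, no test functions.  Nothing here is asserted. -/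

section HyperClust

variable (G : Type) [Group G] [TopologicalSpace G] [IsTopologicalGroup G] [CompactSpace G]
  [MeasurableSpace G] [BorelSpace G] (r : LatticeRep G) (a : ℝ → ℝ)

/-- **Hyperscaling-weighted clustering beyond the femto range in the unit `a`** (IR-light; torus level): for every `ε > 0` there are a
physical distance `D` and thresholds `β₀, Λ₀` such that for `β ≥ β₀`, tori `a(β)·L ≥ Λ₀` and sites `x, y` of the box at physical torus
separation `a(β)·d(x,y) ≥ D`:  `d(x,y)⁸ · |torusCov β L x y| ≤ ε`. -/
def HyperscalingClustering : Prop :=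
  ∀ ε : ℝ, 0 < ε → ∃ D β₀ Λ₀ : ℝ, ∀ β : ℝ, β₀ ≤ β → ∀ L : ℕ, Λ₀ ≤ a β * L →
    ∀ x ∈ box 4 L, ∀ y ∈ box 4 L,
      D ≤ a β * Summit.QuantumFields.YangMills.Cruxes.RunningCouplingCeiling.Pointwise.torusDist L x y →
        Summit.QuantumFields.YangMills.Cruxes.RunningCouplingCeiling.Pointwise.torusDist L x y ^ 8 *
          |Summit.QuantumFields.YangMills.Cruxes.RunningCouplingCeiling.Pointwise.torusCov G r β L x y| ≤ ε

end HyperClust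

/-- **The femto engine interface in a reference unit with hyperscaling clustering**: for every compact simple `G` and `r` ONE unit map
`u → 0⁺` carrying the three engine laws (`FemtoEngineAt G r u`, UV engine output) and hyperscaling-weighted clustering beyond the femto
range (`HyperscalingClustering G r u`, IR-light).  Implies `FemtoEngineFineSigR`, hence `FemtoEngineSigR`, both cruxes and, with the
residual, `NT` (`FemtoEngine.femtoEngineSigR_of_hc`, `FemtoEngine.nt_of_femtoEngineHC`). -/
def FemtoEngineHCSigR : Prop :=
  ∀ (G : Type) [Group G] [TopologicalSpace G] [IsTopologicalGroup G] [CompactSpace G],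
    IsCompactSimpleLieGroup G →
    letI : MeasurableSpace G := borel G
    haveI : BorelSpace G := ⟨rfl⟩
    ∀ (r : LatticeRep G), ∃ u : ℝ → ℝ, (∀ β, 0 < u β) ∧ Filter.Tendsto u Filter.atTop (nhds 0) ∧
      FemtoEngineAt G r u ∧ HyperscalingClustering G r u

end Summit.QuantumFields.YangMills.Cruxes.ResponseLocalisation.Birth

end
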